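import Summits.QuantumFields.BalabanUV.T4Continuum.Support.SubstrateTwoRunsDriven
import Summits.QuantumFields.BalabanUV.T4Continuum.Support.SubstrateLocalization
import Summits.QuantumFields.BalabanUV.T4Continuum.Support.B13CarriersFootprint
import Literature.MathematicalPhysics.QuantumFieldTheory.Balaban1983to89.T4FiniteEpsInhabited

/-!
# SUBSTRATE — EFFECTIVE ACTIONS AND LOCALISED TERMS OF RECORD, and the TOP-DOWN functionals
# `functionalA ∕ functionalB : T4OutputRate.Functional R.carriers R.carriers.BgA ∕ BgB` on the carriers of record — a T4OutputRate
# DATA instance built from Bałaban's density tower (item S-TERM of `substrate/SUBSTRATE-MAP.md`; typer sketch §D1; v1.1)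

v1.1 (DOCFIX + APPEND, typer MAP v0.2 HONEST CORRECTION of S-TERM, seat p1): `functionalA ∕ functionalB` below are the TOP-DOWN Möbius
twins of the CUMULATIVE effective action `A_k` — they are NOT the functionals of record of the step model.  THE FUNCTIONALS OF RECORD
are `B13StepOfRecord.outA ∕ outB` (bottom-up, DEFINED by Bałaban's recursion [II] (2.13) through `Out`; `RepresentsA∕B` by construction,
NE5 O1-e ∕ B13StepDesign R1; MAP §O1 O-2).  `termOfRecord` localises `A_k`, not the created-at-step-`k` terms `E^{(k)}`, and Bałaban's
cluster terms are not the Möbius terms term-by-term.  The LINK between the two is the DISPLAYED top-level representation shape D-4,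
appended here as §5 (`RepresentsTopWith ∕ RepresentsTopA ∕ RepresentsTopB`, sketch v0.2 §D4 verbatim on `DrivenRuns`); all v1
declarations are byte-identical.
v1.2 (APPEND, typer MAP v0.4 D-4′ ∕ located finding F-ne9leaf02g6-1 of the XREAD l.13550): §6 `RepresentsTopBre` — D-4 for run B read at the
RE-INDEXED table `D.gBre` (the sequence node U3, `T4CouplingMatching.disc`, NE5 and NE9 read), sketch v0.4 §D4b verbatim; `RepresentsTopB`
stays as the raw-table variant (one docstring line added); all v1.1 declarations byte-identical.

Cell `pub-balaban`, SUBSTRATE cell, seat `b2b-balaban-substrate-p1` («instances first»).  Summits-side under the LEAN PLACEMENT RULE.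
HONEST FRAMING: rung (B)+1 of the FINITE-VOLUME T⁴ programme — NOT infinite volume, NOT a mass gap, NOT Clay; spine PROVED 0∕9.  This
file DEFINES data and proves definitional ∕ combinatorial identities about it; NO estimate of any NE row (in particular NO decay bound
(0.25), NO η-rate) is claimed, and nothing printed in the audited series is asserted.
HONEST DEPENDENCY (cell line, verbatim): continuum YM on T⁴ ⇐ BetaPertH ∧ nine spine estimates (0/9 proved); BetaPertH ⇐ (D1) ∧ (D4) ∧
CAP+tail; G-an2-4 gates asym, D1 and NE2/3/4.

WHAT IS TYPED (V1 = `Setup` vocabulary throughout, ruling V-1).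
* §1 THE DENSITY TOWER OF ONE RUN `densTower P av g₀ : (k : ℕ) → Density P k G` — `ρ₀ = exp(−A(U)/g₀²)` (the Wilson–Boltzmann weight
  `Missing.boltzmann` at `β = g₀⁻²`), `ρ_{k+1} = T_{av k} ρ_k` with `T` the Radon–Nikodym transport `AveragingRT.rnTransport` of the run's
  own averaging family `av : ∀ j, Averaging P j G` ([Balaban1987RG1] (0.11)–(0.19) pp. 253–255 is the printed recursion WITH the
  characteristic functions and Bałaban's 𝐑; here, as in the tree's `T4FiniteEpsInhabited.rtIterate`, the PURE transform — honest STUB of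
  record); `densTower_eq_rtIterate`: for an all-runs family it IS `rtIterate` BY NAME; `densTower_nonneg`.
* §2 THE EFFECTIVE ACTION `effAction P av g₀ k V := log ρ_k(V) − log ρ_k(1)` (normalised: `effAction_one`; junk where `ρ_k` vanishes —
  nothing is claimed there) and its pull-back to the finest lattice `effActionFine … k U := effAction … k (M^k U)`.
* §3 THE LOCALISED TERMS OF RECORD `termOfRecord P av g₀ cube k X U := locTerm (resField cube) (effActionFine P av g₀ k) X U` — the
  Möbius localisation (`SubstrateLocalization`, p217469) of the scale-`k` effective action over block sets `X` of a block map `cube` of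
  the FINEST lattice; EXACT REPRESENTATION `termSum : Σ_{X ⊆ univ} termOfRecord … k X U = effActionFine … k U` (S-TERM-1); LOCALITY
  `termOfRecord_local` (the term at `X` reads `U` only through its restriction to the blocks of `X` — the SHAPE of [Balaban1987RG1] (0.24)
  p. 257 «depending on U restricted to X»); `termOfRecord_empty`.
* §4 ON THE CARRIERS OF RECORD, for the driven runs `D : DrivenRuns G` (p217182): **`functionalA D g₀A`**, **`functionalB D g₀B`** `:
  T4OutputRate.Functional D.carriers D.carriers.BgA ∕ BgB` (the TOP-DOWN twins, v1.1) — at a domain `⟨k, X⟩ ∈ Σ_k 𝐃_k` and an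
  admissible background, the localised
  scale-`k` term of run A (cube chart OF RECORD `B13CarriersFootprint.toCube R 0 k` of run A's finest lattice, p208379) resp. of run B
  (`toCubeB R 0 k`: run B's finest lattice charted into THE SAME cube torus — the pairing of `B13Carriers`); unfolding lemmas; locality in
  the carriers' words; and the exact representation over ALL block sets (`functionalA_sum_powerset`).
  HONEST NOTES typed in the docstrings: (i) the coupling-SEQUENCE argument of `T4OutputRate.Functional` is NOT READ — the tower of record
  is parametrised by the BARE coupling `g₀` only (Bałaban's reparametrisation by the effective couplings `g_1, …, g_k` and the β-read-out
  are NE7 NODE O ∕ NE9 `margProj` ∕ NE4 content, not supplied); consequently `PrefixDependenceOn` ∕ `NE9` hold for this datum trivially in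
  `g` — recorded, not exploited; (ii) the sum reproducing `A_k` runs over ALL block sets; restricted to CONNECTED families (`R.carriers.Dom`)
  it does NOT in general — that factorisation is exactly the cluster-expansion locality of [Balaban1988RG2Cluster], which this file does
  not have; (iii) no bound of the KIND (0.25) is claimed for these terms.
* §5 (v1.1) THE TOP-LEVEL REPRESENTATION SHAPE D-4 (DISPLAYED, never asserted): `RepresentsTopWith C cat u g ρTop Acl E nLev` —
  «`log ρTop(v) = c − Acl(u v) + Σ_{j < nLev} Σ_{X ∈ cat j} E g (u v) X`» ([Balaban1987RG1] (0.23)–(0.25) pp. 256–257 is its printed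
  model; CONTENT of the convergent cluster expansion [II] (2.13), hence a HYPOTHESIS SHAPE consumed by NE7 NODE O and NE1′ F-2) — and
  its two instances `RepresentsTopA ∕ RepresentsTopB` on the driven runs at `D.uA ∕ D.uB`, tables `D.gA ∕ D.gB`, ONE catalogue `D.domAt`.
Imports BY NAME: `SubstrateTwoRunsDriven` (p217182), `SubstrateLocalization` (p217469), `B13CarriersFootprint` (p208379),
`T4FiniteEpsInhabited`; nothing existing is modified.
-/

noncomputable section

open Finset
open scoped BigOperators

namespace Summit.QuantumFields.BalabanUV.T4Continuum.SubstrateTermsOfRecord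

open Literature.MathematicalPhysics.QuantumFieldTheory.Balaban1983to89
open Literature.MathematicalPhysics.QuantumFieldTheory.Balaban1983to89.Missing (boltzmann boltzmann_pos)
open Literature.MathematicalPhysics.QuantumFieldTheory.Balaban1983to89.AveragingRT (rnTransport rnTransport_nonneg)
open Literature.MathematicalPhysics.QuantumFieldTheory.Balaban1983to89.T4FiniteEpsInhabited (rtIterate)
open Literature.MathematicalPhysics.QuantumFieldTheory.Balaban1983to89.T4OutputRate (Functional)
open Literature.MathematicalPhysics.QuantumFieldTheory.Balaban1983to89.T4Continuum (T4Family)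
open Literature.MathematicalPhysics.QuantumFieldTheory.Balaban1983to89.TreeLengthTorus (TPt)
open Summit.QuantumFields.BalabanUV.T4Continuum.B13Carriers (TwoRuns)
open Summit.QuantumFields.BalabanUV.T4Continuum.B13CarriersFootprint (toCube toCubeB)
open Summit.QuantumFields.BalabanUV.T4Continuum.SubstrateLocalization
open Summit.QuantumFields.BalabanUV.T4Continuum.SubstrateTwoRunsDriven (DrivenRuns)

/-! ## §1 The density tower of one run -/

section Tower

variable (P : Params) {G : Type*} [GaugeGroup G] [MeasurableSpace G] [HaarData G] (av : ∀ j, Averaging P j G) (g₀ : ℝ)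

/-- [folklore] **THE DENSITY TOWER OF RECORD of one run**: `ρ₀ = exp(−A/g₀²)`, `ρ_{k+1} = T_{av k} ρ_k` (Radon–Nikodym transport along the
run's averagings; the characteristic functions and Bałaban's 𝐑 are NOT included — the tree's stub of record, cf. `rtIterate`). -/
def densTower : (k : ℕ) → Density P k G
  | 0 => boltzmann P (g₀⁻¹ ^ 2)
  | k + 1 => rnTransport (av k).avg (densTower k)

/-- [folklore] `ρ₀` is the Wilson–Boltzmann weight at `β = g₀⁻²`. -/
theorem densTower_zero : densTower P av g₀ 0 = boltzmann P (g₀⁻¹ ^ 2) := rfl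

/-- [folklore] `ρ_{k+1} = T ρ_k`. -/
theorem densTower_succ (k : ℕ) : densTower P av g₀ (k + 1) = rnTransport (av k).avg (densTower P av g₀ k) := rfl

/-- [folklore] Every `ρ_k` is pointwise nonnegative. -/
theorem densTower_nonneg : ∀ (k : ℕ) (V : GaugeField P k G), 0 ≤ densTower P av g₀ k V
  | 0, V => (boltzmann_pos P _ V).le
  | k + 1, V => rnTransport_nonneg _ _ (densTower_nonneg k) V

/-- [folklore] `ρ₀ > 0`. -/
theorem densTower_zero_pos (U : GaugeField P 0 G) : 0 < densTower P av g₀ 0 U := boltzmann_pos P _ U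

variable {P} in
/-- [folklore] For the `K`-th run of an ALL-RUNS averaging family the tower IS the tree's `T4FiniteEpsInhabited.rtIterate` (by `rfl` at
every step). -/
theorem densTower_eq_rtIterate (F : T4Family) (avs : (K j : ℕ) → Averaging (F.P K) j G) (K : ℕ) (g₀ : ℝ) :
    ∀ k, densTower (F.P K) (avs K) g₀ k = rtIterate F avs K g₀ k
  | 0 => rfl
  | k + 1 => by rw [densTower_succ, densTower_eq_rtIterate F avs K g₀ k]; rfl

/-! ## §2 The effective action and its pull-back to the finest lattice -/

/-- [folklore] **THE EFFECTIVE ACTION OF RECORD** `A_k(V) := log ρ_k(V) − log ρ_k(1)` (normalised at the trivial configuration; where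
`ρ_k` vanishes `Real.log` returns junk and nothing is claimed). -/
def effAction (k : ℕ) (V : GaugeField P k G) : ℝ :=
  Real.log (densTower P av g₀ k V) - Real.log (densTower P av g₀ k 1)

/-- [folklore] Normalisation: `A_k(1) = 0`. -/
@[simp] theorem effAction_one (k : ℕ) : effAction P av g₀ k 1 = 0 := sub_self _

/-- [folklore] At `k = 0`: `A_0(U) = −g₀⁻²·(A^W(U) − A^W(1))` — minus the Wilson action in units of the bare coupling, normalised. -/
theorem effAction_zero (U : GaugeField P 0 G) :
    effAction P av g₀ 0 U = -(g₀⁻¹ ^ 2) * (wilsonAction4 U - wilsonAction4 (1 : GaugeField P 0 G)) := by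
  simp only [effAction, densTower_zero, boltzmann, Real.log_exp]
  ring

/-- [folklore] THE EFFECTIVE ACTION READ ON THE FINEST LATTICE through the `k`-fold average `M^k` of the run. -/
def effActionFine (k : ℕ) (U : GaugeField P 0 G) : ℝ := effAction P av g₀ k (Averaging.iter av k U)

/-- [folklore] `effActionFine` unfolded. -/
theorem effActionFine_eq (k : ℕ) (U : GaugeField P 0 G) :
    effActionFine P av g₀ k U = effAction P av g₀ k (Averaging.iter av k U) := rfl

/-- [folklore] At `k = 0` no averaging happens. -/
theorem effActionFine_zero (U : GaugeField P 0 G) : effActionFine P av g₀ 0 U = effAction P av g₀ 0 U := rfl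

/-! ## §3 The localised terms of record -/

variable {Bk : Type*} [DecidableEq Bk] (cube : Site P 0 → Bk)

/-- [folklore] **THE LOCALISED TERMS OF RECORD**: the Möbius localisation of the scale-`k` effective action (read on the finest lattice) at
the block set `X` along the restriction of record `resField cube`. -/
def termOfRecord (k : ℕ) (X : Finset Bk) (U : GaugeField P 0 G) : ℝ :=
  locTerm (resField cube) (effActionFine P av g₀ k) X U

/-- [folklore] `termOfRecord` unfolded. -/
theorem termOfRecord_eq (k : ℕ) (X : Finset Bk) (U : GaugeField P 0 G) :
    termOfRecord P av g₀ cube k X U = ∑ Y ∈ X.powerset, (-1 : ℝ) ^ (X.card - Y.card) * effActionFine P av g₀ k (resField cube Y U) :=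
  rfl

/-- [folklore] **S-TERM-1 (EXACT REPRESENTATION)**: over ALL block sets the terms sum back to the effective action,
`Σ_{X ⊆ univ} termOfRecord … k X U = A_k(M^k U)` (`SubstrateLocalization.locSum` + `resLattice_resField`). -/
theorem termSum [Fintype Bk] (k : ℕ) (U : GaugeField P 0 G) :
    ∑ X ∈ (Finset.univ : Finset Bk).powerset, termOfRecord P av g₀ cube k X U = effActionFine P av g₀ k U :=
  locSum (resLattice_resField cube) _ U

/-- [folklore] **LOCALITY**: the term at `X` reads `U` only through its restriction to the blocks of `X` (the SHAPE «depending on `U`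
restricted to `X`»). -/
theorem termOfRecord_local [Fintype Bk] (k : ℕ) (X : Finset Bk) (U : GaugeField P 0 G) :
    termOfRecord P av g₀ cube k X U = termOfRecord P av g₀ cube k X (resField cube X U) :=
  locTerm_local (resLattice_resField cube) _ X U

/-- [folklore] Two configurations agreeing on the bonds sourced in the blocks of `X` have the same term at `X`. -/
theorem termOfRecord_congr [Fintype Bk] (k : ℕ) (X : Finset Bk) {U U' : GaugeField P 0 G}
    (h : ∀ b : PBond P 0, cube b.src ∈ X → U b = U' b) : termOfRecord P av g₀ cube k X U = termOfRecord P av g₀ cube k X U' := by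
  rw [termOfRecord_local, termOfRecord_local (U := U')]
  congr 1
  funext b
  by_cases hb : cube b.src ∈ X
  · rw [resField_apply_of_mem _ _ hb, resField_apply_of_mem _ _ hb, h b hb]
  · rw [resField_apply_of_not_mem _ _ hb, resField_apply_of_not_mem _ _ hb]

/-- [folklore] At the empty block set the term is the effective action of the trivial configuration's `k`-fold average. -/
theorem termOfRecord_empty (k : ℕ) (U : GaugeField P 0 G) :
    termOfRecord P av g₀ cube k ∅ U = effActionFine P av g₀ k (1 : GaugeField P 0 G) := by
  rw [termOfRecord, locTerm_empty, resField_empty]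

end Tower

/-! ## §4 The functionals of record on the carriers of record -/

section Carriers

variable {G : Type} [GaugeGroup G] [MeasurableSpace G] [HaarData G] (D : DrivenRuns G)

/-- [folklore] **RUN A's TOP-DOWN FUNCTIONAL** on the carriers of record (v1.1: the Möbius twin of the cumulative action — NOT the
functional of record of the step model, which is `B13StepOfRecord.outA`): at the domain `⟨k, X⟩` and the admissible run-A background
`U` (a configuration on `T_ε`), the localised scale-`k` term of run A's tower at bare coupling `g₀A`, along the cube chart OF RECORD
`toCube R 0 k` of run A's finest lattice.  HONEST: the coupling-sequence argument is NOT read (bare-coupling parametrisation only). -/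
def functionalA (g₀A : ℝ) : Functional D.carriers D.carriers.BgA :=
  fun _ U X => termOfRecord (D.F.P D.K) D.avA g₀A (toCube D.toTwoRuns 0 X.1) X.1 X.2.1 U.1

/-- [folklore] **RUN B's TOP-DOWN FUNCTIONAL** (v1.1: twin of `B13StepOfRecord.outB`, not a replacement): the same for run B (torus
`K + 1`, spacing `ε/L`), its finest lattice charted into THE SAME cube torus `TPt 4 (cubesPerDir k)` by `toCubeB R 0 k` (the pairing of
`B13Carriers`: `𝐃^B_{k+1} = 𝐃^A_k`), bare coupling `g₀B`. -/
def functionalB (g₀B : ℝ) : Functional D.carriers D.carriers.BgB :=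
  fun _ U X => termOfRecord (D.F.P (D.K + 1)) D.avB g₀B (toCubeB D.toTwoRuns 0 X.1) X.1 X.2.1 U.1

/-- [folklore] `functionalA` unfolded. -/
theorem functionalA_apply (g₀A : ℝ) (g : ℕ → ℝ) (U : D.carriers.BgA) (X : D.carriers.Dom) :
    functionalA D g₀A g U X = termOfRecord (D.F.P D.K) D.avA g₀A (toCube D.toTwoRuns 0 X.1) X.1 X.2.1 U.1 := rfl

/-- [folklore] `functionalB` unfolded. -/
theorem functionalB_apply (g₀B : ℝ) (g : ℕ → ℝ) (U : D.carriers.BgB) (X : D.carriers.Dom) :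
    functionalB D g₀B g U X = termOfRecord (D.F.P (D.K + 1)) D.avB g₀B (toCubeB D.toTwoRuns 0 X.1) X.1 X.2.1 U.1 := rfl

/-- [folklore] HONEST NOTE, kernel form: the functional of record does not read the coupling sequence. -/
theorem functionalA_const_couplings (g₀A : ℝ) (g g' : ℕ → ℝ) : functionalA D g₀A g = functionalA D g₀A g' := rfl

/-- [folklore] Idem for run B. -/
theorem functionalB_const_couplings (g₀B : ℝ) (g g' : ℕ → ℝ) : functionalB D g₀B g = functionalB D g₀B g' := rfl

/-- [folklore] LOCALITY IN THE CARRIERS' WORDS: two admissible run-A backgrounds agreeing on the bonds of `T_ε` whose source lies in a cube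
of `X` give the same value at `X`. -/
theorem functionalA_congr (g₀A : ℝ) (g : ℕ → ℝ) (X : D.carriers.Dom) {U U' : D.carriers.BgA}
    (h : ∀ b : PBond (D.F.P D.K) 0, toCube D.toTwoRuns 0 X.1 b.src ∈ X.2.1 → U.1 b = U'.1 b) :
    functionalA D g₀A g U X = functionalA D g₀A g U' X :=
  termOfRecord_congr _ _ _ _ X.1 X.2.1 h

/-- [folklore] Idem for run B (bonds of `T_{ε/L}`). -/
theorem functionalB_congr (g₀B : ℝ) (g : ℕ → ℝ) (X : D.carriers.Dom) {U U' : D.carriers.BgB}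
    (h : ∀ b : PBond (D.F.P (D.K + 1)) 0, toCubeB D.toTwoRuns 0 X.1 b.src ∈ X.2.1 → U.1 b = U'.1 b) :
    functionalB D g₀B g U X = functionalB D g₀B g U' X :=
  termOfRecord_congr _ _ _ _ X.1 X.2.1 h

/-- [folklore] **EXACT REPRESENTATION OVER ALL BLOCK SETS** (run A): at every scale `k` and admissible background, the terms over ALL
subsets of the cube torus `π_k` sum to run A's scale-`k` effective action at `M^k U`.  HONEST: over the CONNECTED families only
(`R.carriers.Dom`) this fails in general — that is cluster-expansion locality, not available here. -/
theorem functionalA_sum_powerset (g₀A : ℝ) (k : ℕ) (U : D.carriers.BgA) :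
    ∑ X ∈ (Finset.univ : Finset (TPt 4 (D.cubesPerDir k))).powerset,
        termOfRecord (D.F.P D.K) D.avA g₀A (toCube D.toTwoRuns 0 k) k X U.1
      = effActionFine (D.F.P D.K) D.avA g₀A k U.1 :=
  termSum _ _ _ _ k U.1

/-- [folklore] Idem for run B. -/
theorem functionalB_sum_powerset (g₀B : ℝ) (k : ℕ) (U : D.carriers.BgB) :
    ∑ X ∈ (Finset.univ : Finset (TPt 4 (D.cubesPerDir k))).powerset,
        termOfRecord (D.F.P (D.K + 1)) D.avB g₀B (toCubeB D.toTwoRuns 0 k) k X U.1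
      = effActionFine (D.F.P (D.K + 1)) D.avB g₀B k U.1 :=
  termSum _ _ _ _ k U.1

/-- [folklore] THE TWO FUNCTIONALS AT THE DRIVEN BACKGROUNDS (node U3's arguments): run A's at `U^A_K(V)`, run B's at `U^B_{K+1}(V)` —
unfolded, so that a consumer sees exactly which density tower, which averaging family and which cube chart are read. -/
theorem functionals_at_driven (g₀A g₀B : ℝ) (g : ℕ → ℝ) (V : D.domV) (X : D.carriers.Dom) :
    functionalA D g₀A g (D.uA V) X =
        termOfRecord (D.F.P D.K) D.avA g₀A (toCube D.toTwoRuns 0 X.1) X.1 X.2.1 (D.bgA.U D.K (SubstrateTwoRunsDriven.atTop D.K V.1)) ∧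
      functionalB D g₀B g (D.uB V) X =
        termOfRecord (D.F.P (D.K + 1)) D.avB g₀B (toCubeB D.toTwoRuns 0 X.1) X.1 X.2.1
          (D.bgB.U (D.K + 1) (SubstrateTwoRunsDriven.atTop (D.K + 1) V.1)) :=
  ⟨rfl, rfl⟩

end Carriers

/-! ## §5 (v1.1) The top-level representation shape D-4 — DISPLAYED, never asserted -/

section TopIdentity

/-- [folklore] GENERIC SHAPE (typer sketch v0.2 §D4, verbatim): a top-level log-density `ρTop` on a class `V`, read through backgrounds
`u : V → Bg`, is represented by the classical action `Acl` and a functional `E` summed over the catalogue `cat` of all scales `< nLev`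
— the printed MODEL is [Balaban1987RG1] (0.23)–(0.25) pp. 256–257; as a statement about Bałaban's densities it is CONTENT of the
convergent cluster expansion, hence a displayed HYPOTHESIS wherever consumed (NE7 NODE O, NE1′ F-2). -/
def RepresentsTopWith (C : T4OutputRate.Carriers) {V : Type*} {Bg : Type} (cat : ℕ → Finset C.Dom) (u : V → Bg) (g : ℕ → ℝ)
    (ρTop : V → ℝ) (Acl : Bg → ℝ) (E : Functional C Bg) (nLev : ℕ) : Prop :=
  ∃ c : ℝ, ∀ v : V, Real.log (ρTop v) = c - Acl (u v) + ∑ j ∈ Finset.range nLev, ∑ X ∈ cat j, E g (u v) X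

variable {G : Type} [GaugeGroup G]

/-- [folklore] D-4, RUN B (torus `K + 1`): the top density of run B on the driven class is represented by `EB` at the driven backgrounds
`D.uB`, coupling table `D.gB`, ONE catalogue `D.domAt` for both runs (B13StepDesign OBS «common unit lattice»).  DISPLAYED.  (v1.2: this is
the RAW-table variant; consumers on the common carriers use `RepresentsTopBre` — run B's unpaired `g^B_0` ∕ scale-0 terms are absorbed into
`c ∕ Acl ∕ EB` per `T4OutputRate` §1.) -/
def RepresentsTopB (D : DrivenRuns G) (ρTop : D.domV → ℝ) (Acl : D.carriers.BgB → ℝ) (EB : Functional D.carriers D.carriers.BgB)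
    (nLev : ℕ) : Prop :=
  RepresentsTopWith D.carriers D.domAt D.uB D.gB ρTop Acl EB nLev

/-- [folklore] D-4, RUN A (torus `K`): the same shape at `D.uA`, table `D.gA`.  DISPLAYED. -/
def RepresentsTopA (D : DrivenRuns G) (ρTop : D.domV → ℝ) (Acl : D.carriers.BgA → ℝ) (EA : Functional D.carriers D.carriers.BgA)
    (nLev : ℕ) : Prop :=
  RepresentsTopWith D.carriers D.domAt D.uA D.gA ρTop Acl EA nLev

/-- [folklore] The shape unfolds to its sentence (by `Iff.rfl`; recorded so the convention is visible in the kernel). -/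
theorem representsTopA_iff (D : DrivenRuns G) (ρTop : D.domV → ℝ) (Acl : D.carriers.BgA → ℝ)
    (EA : Functional D.carriers D.carriers.BgA) (nLev : ℕ) :
    RepresentsTopA D ρTop Acl EA nLev ↔
      ∃ c : ℝ, ∀ v : D.domV, Real.log (ρTop v) =
        c - Acl (D.uA v) + ∑ j ∈ Finset.range nLev, ∑ X ∈ D.domAt j, EA D.gA (D.uA v) X :=
  Iff.rfl

/-- [folklore] The shape is insensitive to the normalisation constant: for a nowhere-vanishing top density, rescaling by `a > 0`
preserves it (the constant shifts by `log a`). -/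
theorem RepresentsTopWith.smul_const {C : T4OutputRate.Carriers} {V : Type*} {Bg : Type} {cat : ℕ → Finset C.Dom} {u : V → Bg}
    {g : ℕ → ℝ} {ρTop : V → ℝ} {Acl : Bg → ℝ} {E : Functional C Bg} {nLev : ℕ} (h : RepresentsTopWith C cat u g ρTop Acl E nLev)
    (hρ : ∀ v, ρTop v ≠ 0) {a : ℝ} (ha : 0 < a) : RepresentsTopWith C cat u g (fun v => a * ρTop v) Acl E nLev := by
  obtain ⟨c, hc⟩ := h
  refine ⟨c + Real.log a, fun v => ?_⟩
  rw [Real.log_mul ha.ne' (hρ v), hc v]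
  ring

end TopIdentity

/-! ## §6 (v1.2) D-4 for run B at the RE-INDEXED table (F-ne9leaf02g6-1; sketch v0.4 §D4b verbatim) -/

section TopIdentityRe

variable {G : Type} [GaugeGroup G]

/-- [folklore] D-4, RUN B, RE-INDEXED TABLE: the top density of run B on the driven class is represented by `EB` at `D.uB` read at
`D.gBre = fun j => D.gB (j+1)` — the sequence node U3 (`u3_threeBrackets_driven`), `T4CouplingMatching.disc` and NE5∕NE9 read; run B's
unpaired first coupling `g^B_0` and its scale-0 terms are absorbed into `c ∕ Acl ∕ EB` (`T4OutputRate` §1).  DISPLAYED, consumed BY NAME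
(NE7 NODE O.1, NE1′, NE4). -/
def RepresentsTopBre (D : DrivenRuns G) (ρTop : D.domV → ℝ) (Acl : D.carriers.BgB → ℝ) (EB : Functional D.carriers D.carriers.BgB)
    (nLev : ℕ) : Prop :=
  RepresentsTopWith D.carriers D.domAt D.uB D.gBre ρTop Acl EB nLev

/-- [folklore] `RepresentsTopBre` unfolded. -/
theorem representsTopBre_iff (D : DrivenRuns G) (ρTop : D.domV → ℝ) (Acl : D.carriers.BgB → ℝ)
    (EB : Functional D.carriers D.carriers.BgB) (nLev : ℕ) :
    RepresentsTopBre D ρTop Acl EB nLev ↔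
      ∃ c : ℝ, ∀ v : D.domV, Real.log (ρTop v) = c - Acl (D.uB v) +
        ∑ j ∈ Finset.range nLev, ∑ X ∈ D.domAt j, EB D.gBre (D.uB v) X := Iff.rfl

/-- [folklore] The two run-B readings differ exactly by the table (`D.gB` vs `D.gBre`): for a TABLE-BLIND functional they coincide (e.g. the
top-down `functionalB`, `functionalB_const_couplings`). -/
theorem representsTopBre_iff_representsTopB_of_tableBlind (D : DrivenRuns G) (ρTop : D.domV → ℝ) (Acl : D.carriers.BgB → ℝ)
    (EB : Functional D.carriers D.carriers.BgB) (hEB : ∀ g g' U X, EB g U X = EB g' U X) (nLev : ℕ) :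
    RepresentsTopBre D ρTop Acl EB nLev ↔ RepresentsTopB D ρTop Acl EB nLev := by
  unfold RepresentsTopBre RepresentsTopB RepresentsTopWith
  simp_rw [hEB D.gBre D.gB]

/-- [folklore] In particular for the top-down functional of run B (which does not read the couplings) the two readings coincide. -/
theorem representsTopBre_functionalB_iff [MeasurableSpace G] [HaarData G] (D : DrivenRuns G) (g₀B : ℝ) (ρTop : D.domV → ℝ)
    (Acl : D.carriers.BgB → ℝ) (nLev : ℕ) :
    RepresentsTopBre D ρTop Acl (functionalB D g₀B) nLev ↔ RepresentsTopB D ρTop Acl (functionalB D g₀B) nLev :=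
  representsTopBre_iff_representsTopB_of_tableBlind D ρTop Acl _ (fun _ _ _ _ => rfl) nLev

end TopIdentityRe

end Summit.QuantumFields.BalabanUV.T4Continuum.SubstrateTermsOfRecord

end
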